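import Summits.BirchSwinnertonDyer.Rank1Residual.Partition.GrossZagierTwistValuation
import Summits.BirchSwinnertonDyer.Rank1Residual.X1.RankZeroHeightIndex
import Summits.BirchSwinnertonDyer.Rank1Residual.AdditivePotMult.RankZeroShaAnIdentity
import HarnessLib

/-!
# CGLS22 display (5.6) `p`-adically in the SWAPPED orientation: `E/ℚ` of analytic rank ZERO, the
# twist `E^K` of analytic rank ONE — `ord_p q + ord_p q_d = 2·ord_p [E(K):ℤP] − 2·ord_p c_E − 2·ord_p #E(K)_tors`
# (cell `bsd-eis`, seat `bsd-eis-k5-c5`; route `EisensteinPrimes` crux 5 = row A3)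

HONEST FRAMING (cell `bsd-eis`, home `run/shared/lean/pub/bsd-eis/`; FULL-BSD rank-≤1 programme,
row A3 = X1 ∩ {r_an = 0}). THEOREMS ONLY; Gross–Zagier bookkeeping over already-landed definitions
and named facts taken as binders; nothing about any particular curve, nothing booked, no label moves.

The tree's `TwistIdentity.padicValRat_add_eq_of_grossZagier`
(`Partition/GrossZagierTwistValuation.lean`, lit-cgls) is display (5.6) of the proof of
Castella–Grossi–Lee–Skinner 2022 Thm. 5.3.1, `p`-adically and exactly, for `E` of analytic rank ONE
and `K` with `L(E^K,1) ≠ 0`. This file proves the same identity when the ranks are EXCHANGED — `E`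
of analytic rank `0`, `K` a Heegner field with `ord_{s=1} L(E^K, s) = 1` (Bump–Friedberg–Hoffstein),
`P ∈ E(K)` the Heegner point (then in the `(-1)`-eigenspace of `Gal(K/ℚ)`) —, which is the
Gross–Zagier half of the MIRROR display `X1.RankZeroPartner.RankZeroDisplay` (route H of the sub-cell
`eisenstein-p1`; Keller–Yin's display with the roles of `E` and `E^K` exchanged):
`TwistIdentity.padicValRat_add_eq_of_grossZagier_swap` — for `q = L(E,1)/Ω_E` and
`q_d = L'(E^{(d_K)},1)/(Ω·Reg)` (on a minimal model `Wd` of the twist),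
`ord_p q + ord_p q_d = 2·ord_p [E(K):ℤP] − 2·ord_p c(Dt) − 2·ord_p #E(K)_tors`.
Inputs (binders, named facts of the tree): Gross–Zagier (`gross_zagier`), Kolyvagin (`kolyvagin`),
GZK over `ℚ`, modularity (`hasEntireLFunction_rat`). New ingredient: the minus-part height–index
relation `X1.RankZeroHeightIndex.exists_mul_canonicalHeight_eq_index_sq_mul_regulator_twist`
(`m·#E(K)_tors²·ĥ_K(P) = 2·[E(K):ℤP]²·Reg(E^{(c)}/ℚ)`); the real-number algebra and the `p`-adic
valuations are the transcript of the rank-one file (same rational number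
`Q = 8 I²/(n m t_K² c² w² q_d |u|)`). Prior art in the tree: the sub-cell `additive-p1` proved the
same swapped bookkeeping in the `#Ш_an`-currency under `p ∤ c(Dt)`
(`AdditivePotMult.exists_shaAn_padicVal_eq_of_heegner_rankZero`, with its own minus-part height lemma
`AdditivePotMult.exists_mul_canonicalHeight_eq_index_sq_mul_regulator_twist`); the present statement
KEEPS the Manin constant (the currency of [CGLS] (5.5)/(5.7) and of ky's `display57_at_goodLattice`)
and reuses that file's product rule `AdditivePotMult.lDerivEK_eq_mul_deriv`.

References: [CastellaGrossiLeeSkinner2022] proof of Thm. 5.3.1, (5.6); [GrossZagier1986] I.(6.5),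
V.§2; [JetchevSkinnerWan2017] §7.4.1; [KellerYin2024] proof of Thm. 4.2.1 (display, roles exchanged);
cell file HOME/bsd-eis-ky-MEMO-1.md §5.2 (Theorem B).
-/

set_option autoImplicit false

noncomputable section

open scoped Classical

open WeierstrassCurve NumberField Literature.NumberTheory.EllipticCurves
  Literature.NumberTheory.EllipticCurves.ModularForms Literature.NumberTheory.QuadraticFields
  Literature.NumberTheory.EllipticCurves.Rank1Residual
  Literature.NumberTheory.EllipticCurves.KrizLi2019
  Summit.BirchSwinnertonDyer.Rank1Residual.X1.RankZeroHeightIndex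

namespace Summit.BirchSwinnertonDyer.Rank1Residual

/-! ### §0 Small transport lemmas -/

/-- Equal Weierstrass equations have equal regulators (proof-irrelevance of the `IsElliptic`
instances). [folklore] -/
theorem TwistIdentity.regulator_congr {V₁ V₂ : WeierstrassCurve ℚ} [V₁.IsElliptic] [V₂.IsElliptic]
    (h : V₁ = V₂) : V₁.regulator = V₂.regulator := by
  subst h
  rfl

/-- Equal Weierstrass equations have equal Mordell–Weil ranks. [folklore] -/
theorem TwistIdentity.mordellWeilRank_congr {V₁ V₂ : WeierstrassCurve ℚ} (h : V₁ = V₂) :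
    V₁.mordellWeilRank = V₂.mordellWeilRank := by
  subst h
  rfl

/-! ### §1 (5.6) `p`-adically, ranks exchanged -/

/-- **(5.6) of the proof of CGLS22 Thm. 5.3.1, `p`-adically, in the SWAPPED orientation: `E/ℚ` of
analytic rank `0`, `E^{(d_K)}` of analytic rank `1`.** For `q = L(E,1)/Ω_E` and
`q_d = L'(E^{(d_K)},1)/(Ω_{E^{(d_K)}}·Reg(E^{(d_K)}/ℚ))` (computed on a globally minimal model `Wd`):
`ord_p q + ord_p q_d = 2·ord_p [E(K):ℤP] − 2·ord_p c(Dt) − 2·ord_p #E(K)_tors`. Data: `W/ℚ`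
globally minimal of conductor `N`; `K` imaginary quadratic with the Heegner hypothesis for `N`;
`P ∈ E(K)` the Heegner point of the parametrisation datum `Dt` (Manin constant `Dt.c`, KEPT);
`p` odd with `p ∤ #𝓞_K^×` (`hμ`); `Wd = Cd • E^{(d_K)}` globally minimal with `ord_p u(Cd) = 0` (`hu`)
and `ord_{s=1} L(Wd,s) = 1` (`hrd`); `ord_{s=1} L(E,s) = 0` (`hr`). PUBLISHED inputs as binders:
Gross–Zagier (`hGZ`), Kolyvagin (`hKo`), GZK over `ℚ` (`hGZK`), modularity (`hmod`). Computation: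
`L'(E/K,1) = L(E,1)·L'(E^K,1)` (`AdditivePotMult.lDerivEK_eq_mul_deriv`), Gross–Zagier
`L'(E/K,1) = (4B/(c²w²))·ĥ(P)`, the period relation `Ω_E Ω_{E^D} = n·B`, and the MINUS-part
height–index relation `m·t_K²·ĥ(P) = 2 I² Reg(E^{(d_K)}/ℚ)`
(`RankZeroHeightIndex.exists_mul_canonicalHeight_eq_index_sq_mul_regulator_twist`, through
`K = ℚ(√c)`, `d_K = c q₀²`, `E^{(c)} ≅ E^{(d_K)} ≅ Wd`); hence `q·q_d = 8 I²/(n m t_K² c² w² |u|)`,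
then `ord_p`. [cite: CastellaGrossiLeeSkinner2022, proof of Thm. 5.3.1, display (5.6) (TeX `eq:GZ`)]
[cite: GrossZagier1986, I.(6.5) and V.§2 (pp. 310–312)] [cite: KellerYin2024, proof of Thm. 4.2.1 (display; roles of E and E^K exchanged)] -/
theorem TwistIdentity.padicValRat_add_eq_of_grossZagier_swap
    (W : WeierstrassCurve ℚ) [W.IsElliptic] [W.IsGloballyMinimal] (p : ℕ) [Fact p.Prime]
    (N : ℕ) [NeZero N] (K : Type) [Field K] [NumberField K]
    (Dt : ModularParametrizationData W N) (H : HeegnerDatum N (NumberField.discr K)) (ι : K →+* ℂ)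
    (P : (W.baseChange K).toAffine.Point)
    -- the published inputs (named facts of the tree)
    (hGZ : gross_zagier N W K) (hKo : kolyvagin N W K)
    (hGZK : rank_eq_analyticRank_of_analyticRank_le_one) (hmod : hasEntireLFunction_rat)
    -- the data
    (hK : IsImaginaryQuadratic K) (hHN : SatisfiesHeegnerHypothesis N K)
    (hP : WeierstrassCurve.Affine.Point.map ι.toRatAlgHom P = heegnerPointComplex Dt H)
    (hp2 : p ≠ 2) (hμ : ¬ p ∣ Units.torsionOrder K) (hr : W.analyticRank = 0)
    -- a globally minimal model of the quadratic twist by `d_K`, of analytic rank one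
    (Wd : WeierstrassCurve ℚ) [Wd.IsElliptic] [Wd.IsGloballyMinimal] (Cd : VariableChange ℚ)
    (hWd : Cd • W.quadraticTwist (NumberField.discr K : ℚ) = Wd) (hu : padicValRat p (Cd.u : ℚ) = 0)
    (hrd : Wd.analyticRank = 1)
    -- the two rationals of the display
    (q qd : ℚ) (hq : W.entireLFunction 1 / (W.realPeriodRat : ℂ) = (q : ℂ))
    (hqd : Wd.leadingLCoeff / ((Wd.realPeriodRat * Wd.regulator : ℝ) : ℂ) = (qd : ℂ)) :
    padicValRat p q + padicValRat p qd =
      2 * (padicValNat p (AddSubgroup.zmultiples P).index : ℤ) - 2 * (padicValInt p Dt.c : ℤ) -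
        2 * (padicValNat p (W.baseChange K).torsionOrder : ℤ) := by
  have hpp : p.Prime := Fact.out
  haveI hEK : (W.baseChange K).IsElliptic := isElliptic_baseChange' W K
  obtain ⟨h2, hKtc⟩ := hK
  haveI : IsTotallyComplex K := hKtc
  have hD0 : (NumberField.discr K : ℚ) ≠ 0 := by exact_mod_cast NumberField.discr_ne_zero K
  haveI hEt : (W.quadraticTwist (NumberField.discr K : ℚ)).IsElliptic :=
    W.isElliptic_quadraticTwist hD0
  ---------------------------------------------------------------- `L`-values over `ℚ` and `K`
  have hLt' : (W.quadraticTwist (NumberField.discr K : ℚ)).entireLFunction = Wd.entireLFunction := by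
    rw [← hWd, entireLFunction_smul]
  have hL0d : Wd.entireLFunction 1 = 0 := entireLFunction_one_eq_zero_of_analyticRank_eq_one hrd
  obtain ⟨hleadd, hderivd⟩ := leadingLCoeff_eq_deriv_of_analyticRank_eq_one hrd
  have hLt0 : (W.quadraticTwist (NumberField.discr K : ℚ)).entireLFunction 1 = 0 := by
    rw [hLt']; exact hL0d
  have hprod : LDerivEK W K = W.entireLFunction 1 * deriv Wd.entireLFunction 1 := by
    rw [AdditivePotMult.lDerivEK_eq_mul_deriv W K hmod hLt0, hLt']
  have hLW : W.entireLFunction 1 ≠ 0 := (W.analyticRank_eq_zero_iff_holds (hmod W)).1 hr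
  have hLK : LDerivEK W K ≠ 0 := by
    rw [hprod]; exact mul_ne_zero hLW hderivd
  ---------------------------------------------------------------- the Heegner point is non-torsion; Kolyvagin
  have hPH : IsHeegnerPoint N W K P := ⟨Dt, H, ι, hP⟩
  have hPinf : ¬ IsOfFinAddOrder P :=
    (lDerivEK_ne_zero_iff_not_isOfFinAddOrder W N K hGZ ⟨h2, hKtc⟩ hHN hPH).mp hLK
  obtain ⟨hrkK, -⟩ := hKo ⟨h2, hKtc⟩ hHN hPH hPinf
  ---------------------------------------------------------------- ranks over `ℚ`: `E(ℚ)` finite, `rank Wd(ℚ) = 1`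
  have hr1 : W.analyticRank ≤ 1 := by omega
  have hrQ : W.mordellWeilRank = 0 := by rw [(hGZK W hr1).1, hr]
  haveI hfinW : Finite W.toAffine.Point := W.mordellWeilRank_eq_zero_iff_holds.mp hrQ
  have hrkd : Wd.mordellWeilRank = 1 := by rw [(hGZK Wd (le_of_eq hrd)).1, hrd]
  ---------------------------------------------------------------- `K = ℚ(√c)`, `d_K = c q₀²`, `E^{(c)} ≅ E^{(d_K)} ≅ Wd`
  obtain ⟨θ, c, hθ, hc⟩ := Quadratic.exists_sq_eq_algebraMap (F := ℚ) (K := K) h2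
  obtain ⟨q₀, hq₀, hdc⟩ := NumberField.exists_discr_eq_mul_sq h2 hθ hc
  obtain ⟨C₀, hC₀⟩ := W.exists_variableChange_quadraticTwist_mul_sq c q₀ hq₀
  rw [← hdc] at hC₀
  have hc0 : c ≠ 0 := Quadratic.sq_ne_zero_of_not_mem_range hθ hc
  haveI hEc : (W.quadraticTwist c).IsElliptic := W.isElliptic_quadraticTwist hc0
  have hrt : (W.quadraticTwist c).mordellWeilRank = 1 := by
    have h1 : (C₀ • W.quadraticTwist c).mordellWeilRank = (W.quadraticTwist c).mordellWeilRank :=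
      mordellWeilRank_variableChange_holds _ C₀
    have h3 : (Cd • W.quadraticTwist (NumberField.discr K : ℚ)).mordellWeilRank =
        (W.quadraticTwist (NumberField.discr K : ℚ)).mordellWeilRank :=
      mordellWeilRank_variableChange_holds _ Cd
    rw [← h1, TwistIdentity.mordellWeilRank_congr hC₀, ← h3, TwistIdentity.mordellWeilRank_congr hWd,
      hrkd]
  have hRt : (W.quadraticTwist c).regulator = Wd.regulator := by
    have h1 : (C₀ • W.quadraticTwist c).regulator = (W.quadraticTwist c).regulator :=
      regulator_variableChange_holds _ C₀
    have h3 : (Cd • W.quadraticTwist (NumberField.discr K : ℚ)).regulator =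
        (W.quadraticTwist (NumberField.discr K : ℚ)).regulator :=
      regulator_variableChange_holds _ Cd
    rw [← h1, TwistIdentity.regulator_congr hC₀, ← h3, TwistIdentity.regulator_congr hWd]
  ---------------------------------------------------------------- heights and index, MINUS part
  obtain ⟨m, hm, hheight⟩ :=
    exists_mul_canonicalHeight_eq_index_sq_mul_regulator_twist W K h2 hθ hc hfinW hrkK hrt P hPinf
  rw [hRt] at hheight
  ---------------------------------------------------------------- Gross–Zagier and the period
  have hLD := (hGZ ⟨h2, hKtc⟩ hHN) Dt H ι P hP
  have hper := two_mul_covolume_div_sqrt_eq_bsdPeriod W K Dt h2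
  have hΩ := W.realPeriod_mul_realPeriod_quadraticTwist_eq_mul_bsdPeriod K h2
  have hΩd : Wd.realPeriodRat =
      |((Cd.u : ℚ) : ℝ)| * (W.quadraticTwist (NumberField.discr K : ℚ)).realPeriodRat := by
    rw [← hWd]; exact realPeriodRat_smul_holds (W.quadraticTwist _) Cd
  ---------------------------------------------------------------- positivity of everything
  have hΩW : 0 < W.realPeriodRat := W.realPeriodRat_pos_holds
  have hΩt : 0 < (W.quadraticTwist (NumberField.discr K : ℚ)).realPeriodRat :=
    (W.quadraticTwist _).realPeriodRat_pos_holds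
  have hΩdpos : 0 < Wd.realPeriodRat := Wd.realPeriodRat_pos_holds
  have hRd : 0 < Wd.regulator := Wd.regulator_pos'
  have htK : 0 < (W.baseChange K).torsionOrder := (W.baseChange K).torsionOrder_pos_holds
  have hcM0 : Dt.c ≠ 0 := Dt.maninConstant_ne_zero_holds
  have hcM : (Dt.c : ℚ) ≠ 0 := by exact_mod_cast hcM0
  have hw : 0 < Units.torsionOrder K := Units.torsionOrder_pos K
  have huu : (Cd.u : ℚ) ≠ 0 := Cd.u.ne_zero
  have hm0 : 0 < m := by rcases hm with rfl | rfl <;> norm_num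
  have hI0 : (AddSubgroup.zmultiples P).index ≠ 0 := by
    intro hI
    rw [hI] at hheight
    have h0 : (m : ℝ) * ((W.baseChange K).torsionOrder : ℝ) ^ 2 * P.canonicalHeight = 0 := by
      rw [hheight]; simp
    have hh0 : P.canonicalHeight = 0 := by
      rcases mul_eq_zero.mp h0 with h' | h'
      · rcases mul_eq_zero.mp h' with h'' | h''
        · exact absurd (by exact_mod_cast h'' : m = 0) hm0.ne'
        · exact absurd (pow_eq_zero_iff two_ne_zero |>.mp h'') (by exact_mod_cast htK.ne')
      · exact h'
    exact hPinf ((Affine.Point.canonicalHeight_eq_zero_iff_holds P).mp hh0)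
  set n := (W.baseChange ℝ).numRealComponents with hn_def
  have hn : n = 1 ∨ n = 2 := numRealComponents_eq_one_or W
  have hn0 : 0 < n := by rcases hn with h' | h' <;> omega
  -- the two `L`-values as real multiples
  have hΩWC : (W.realPeriodRat : ℂ) ≠ 0 := by exact_mod_cast hΩW.ne'
  have hLWq : W.entireLFunction 1 = (((q : ℝ) * W.realPeriodRat : ℝ) : ℂ) := by
    have := (div_eq_iff hΩWC).mp hq
    rw [this]; push_cast; ring
  have hq0 : q ≠ 0 := by
    intro h0
    apply hLW
    rw [hLWq, h0]; simp
  have hΩRdC : ((Wd.realPeriodRat * Wd.regulator : ℝ) : ℂ) ≠ 0 := by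
    exact_mod_cast (mul_pos hΩdpos hRd).ne'
  have hLdq : deriv Wd.entireLFunction 1 = (((qd : ℝ) * (Wd.realPeriodRat * Wd.regulator) : ℝ) : ℂ) := by
    have := (div_eq_iff hΩRdC).mp hqd
    rw [← hleadd, this]; push_cast; ring
  have hqd0 : qd ≠ 0 := by
    intro h0
    apply hderivd
    rw [hLdq, h0]; simp
  ---------------------------------------------------------------- the rational number `Q = q`
  set I := (AddSubgroup.zmultiples P).index with hI_def
  set Q : ℚ := 8 * (I : ℚ) ^ 2 /
      ((n : ℚ) * (m : ℚ) * ((W.baseChange K).torsionOrder : ℚ) ^ 2 * (Dt.c : ℚ) ^ 2 *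
        (Units.torsionOrder K : ℚ) ^ 2 * qd * |(Cd.u : ℚ)|) with hQ_def
  ---------------------------------------------------------------- real abbreviations
  set ΩW := W.realPeriodRat with hΩW_def
  set Ωt := (W.quadraticTwist (NumberField.discr K : ℚ)).realPeriodRat with hΩt_def
  set B := (W.baseChange K).bsdPeriod with hB_def
  set Rd := Wd.regulator with hRd_def
  set hh := P.canonicalHeight with hhh_def
  set tK := (W.baseChange K).torsionOrder with htK_def
  set w := Units.torsionOrder K with hw_def
  set cM := Dt.c with hcM_def
  set u := (Cd.u : ℚ) with hu_def
  have hΩW' : ΩW = (W.baseChange ℝ).realPeriod := rfl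
  have hΩt' : Ωt = ((W.quadraticTwist (NumberField.discr K : ℚ)).baseChange ℝ).realPeriod := rfl
  rw [← hΩW', ← hΩt'] at hΩ
  -- `B = ΩW Ωt / n`, `ĥ = 2 I² Rd / (m tK²)`, the Gross–Zagier constant `= 4 B / (c² w²)`
  have hBeq : B = ΩW * Ωt / n := by
    rw [hΩ]; field_simp
  have hheq : hh = 2 * (I : ℝ) ^ 2 * Rd / ((m : ℝ) * (tK : ℝ) ^ 2) := by
    rw [← hheight]; field_simp
  have hGZc : 2 * ZLattice.covolume Dt.L.lattice /
        ((cM : ℝ) ^ 2 * ((w : ℝ) / 2) ^ 2 * √|(NumberField.discr K : ℝ)|) =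
      4 * B / ((cM : ℝ) ^ 2 * (w : ℝ) ^ 2) := by
    rw [← hper]; field_simp; ring
  -- `L(E,1) · L'(Wd,1) = (4B/(c²w²)) ĥ` as real numbers, i.e. `q ΩW · qd |u| Ωt Rd = …`
  have hreal : (q : ℝ) * ΩW * ((qd : ℝ) * (|(u : ℝ)| * Ωt * Rd)) =
      4 * B / ((cM : ℝ) ^ 2 * (w : ℝ) ^ 2) * hh := by
    have key : W.entireLFunction 1 * deriv Wd.entireLFunction 1 =
        ((4 * B / ((cM : ℝ) ^ 2 * (w : ℝ) ^ 2) * hh : ℝ) : ℂ) := by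
      rw [← hprod, hLD, hGZc]
    rw [hLWq, hLdq, hΩd] at key
    have key' : (((q : ℝ) * ΩW * ((qd : ℝ) * (|(u : ℝ)| * Ωt * Rd)) : ℝ) : ℂ) =
        ((4 * B / ((cM : ℝ) ^ 2 * (w : ℝ) ^ 2) * hh : ℝ) : ℂ) := by
      rw [← key]; push_cast; ring
    exact_mod_cast key'
  -- hence `q = Q`
  have hqQ : q = Q := by
    have hn' : (n : ℝ) ≠ 0 := by exact_mod_cast hn0.ne'
    have hm' : (m : ℝ) ≠ 0 := by exact_mod_cast hm0.ne'
    have htK' : (tK : ℝ) ≠ 0 := by exact_mod_cast htK.ne'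
    have hcM' : (cM : ℝ) ≠ 0 := by exact_mod_cast hcM0
    have hw' : (w : ℝ) ≠ 0 := by exact_mod_cast hw.ne'
    have hu' : |(u : ℝ)| ≠ 0 := abs_ne_zero.mpr (by exact_mod_cast huu)
    have hqd' : (qd : ℝ) ≠ 0 := by exact_mod_cast hqd0
    have hΩW0 : ΩW ≠ 0 := hΩW.ne'
    have hΩt0 : Ωt ≠ 0 := hΩt.ne'
    have hR0 : Rd ≠ 0 := hRd.ne'
    have hQR : (q : ℝ) = (Q : ℝ) := by
      rw [hheq, hBeq] at hreal
      rw [hQ_def]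
      push_cast
      rw [eq_div_iff (by
        have : (n : ℝ) * (m : ℝ) * (tK : ℝ) ^ 2 * (cM : ℝ) ^ 2 * (w : ℝ) ^ 2 * (qd : ℝ) * |(u : ℝ)| ≠ 0 :=
          mul_ne_zero (mul_ne_zero (mul_ne_zero (mul_ne_zero (mul_ne_zero (mul_ne_zero hn' hm')
            (pow_ne_zero _ htK')) (pow_ne_zero _ hcM')) (pow_ne_zero _ hw')) hqd') hu'
        exact_mod_cast this)]
      field_simp at hreal
      linear_combination hreal
    exact_mod_cast hQR
  ---------------------------------------------------------------- `p`-adic valuations (verbatim the rank-one file)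
  have hI' : (I : ℚ) ≠ 0 := by exact_mod_cast hI0
  have htKq : (tK : ℚ) ≠ 0 := by exact_mod_cast htK.ne'
  have hn' : (n : ℚ) ≠ 0 := by exact_mod_cast hn0.ne'
  have hm' : (m : ℚ) ≠ 0 := by exact_mod_cast hm0.ne'
  have hw' : (w : ℚ) ≠ 0 := by exact_mod_cast hw.ne'
  have hua : |u| ≠ 0 := abs_ne_zero.mpr huu
  have h8 : padicValRat p (8 : ℚ) = 0 := by
    rw [show (8 : ℚ) = ((8 : ℕ) : ℚ) by norm_num, padicValRat.of_nat]
    have : ¬ p ∣ 8 := by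
      intro h
      have h' : p ∣ 2 ^ 3 := by simpa using h
      exact hp2 ((Nat.prime_dvd_prime_iff_eq hpp Nat.prime_two).mp (hpp.dvd_of_dvd_pow h'))
    simp [padicValNat.eq_zero_of_not_dvd this]
  have hvn : padicValRat p (n : ℚ) = 0 := by
    rw [padicValRat.of_nat]
    have : ¬ p ∣ n := by
      rcases hn with h' | h'
      · rw [h']; exact hpp.one_lt.ne' ∘ Nat.dvd_one.mp
      · rw [h']; intro hd; exact hp2 ((Nat.prime_dvd_prime_iff_eq hpp Nat.prime_two).mp hd)
    simp [padicValNat.eq_zero_of_not_dvd this]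
  have hvm : padicValRat p (m : ℚ) = 0 := by
    rw [padicValRat.of_nat]
    have : ¬ p ∣ m := by
      rcases hm with rfl | rfl
      · exact hpp.one_lt.ne' ∘ Nat.dvd_one.mp
      · intro hd
        have h' : p ∣ 2 ^ 2 := by simpa using hd
        exact hp2 ((Nat.prime_dvd_prime_iff_eq hpp Nat.prime_two).mp (hpp.dvd_of_dvd_pow h'))
    simp [padicValNat.eq_zero_of_not_dvd this]
  have hvw : padicValRat p (w : ℚ) = 0 := by
    rw [padicValRat.of_nat, padicValNat.eq_zero_of_not_dvd hμ]; rfl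
  have hvu : padicValRat p |u| = 0 := by
    rcases abs_choice u with h' | h'
    · rw [h']; exact hu
    · rw [h', padicValRat.neg]; exact hu
  -- nonvanishing of the partial products
  have hA1 : (8 : ℚ) * (I : ℚ) ^ 2 ≠ 0 := mul_ne_zero (by norm_num) (pow_ne_zero _ hI')
  have hD1 : (n : ℚ) * (m : ℚ) ≠ 0 := mul_ne_zero hn' hm'
  have hD2 : (n : ℚ) * (m : ℚ) * (tK : ℚ) ^ 2 ≠ 0 := mul_ne_zero hD1 (pow_ne_zero _ htKq)
  have hD3 : (n : ℚ) * (m : ℚ) * (tK : ℚ) ^ 2 * (cM : ℚ) ^ 2 ≠ 0 :=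
    mul_ne_zero hD2 (pow_ne_zero _ hcM)
  have hD4 : (n : ℚ) * (m : ℚ) * (tK : ℚ) ^ 2 * (cM : ℚ) ^ 2 * (w : ℚ) ^ 2 ≠ 0 :=
    mul_ne_zero hD3 (pow_ne_zero _ hw')
  have hD5 : (n : ℚ) * (m : ℚ) * (tK : ℚ) ^ 2 * (cM : ℚ) ^ 2 * (w : ℚ) ^ 2 * qd ≠ 0 :=
    mul_ne_zero hD4 hqd0
  have hD6 : (n : ℚ) * (m : ℚ) * (tK : ℚ) ^ 2 * (cM : ℚ) ^ 2 * (w : ℚ) ^ 2 * qd * |u| ≠ 0 :=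
    mul_ne_zero hD5 hua
  have hnum : padicValRat p ((8 : ℚ) * (I : ℚ) ^ 2) = 2 * padicValNat p I := by
    rw [padicValRat.mul (by norm_num) (pow_ne_zero _ hI'), padicValRat.pow, h8, padicValRat.of_nat]
    push_cast; ring
  have hden : padicValRat p ((n : ℚ) * (m : ℚ) * (tK : ℚ) ^ 2 * (cM : ℚ) ^ 2 * (w : ℚ) ^ 2 *
      qd * |u|) = 2 * padicValNat p tK + 2 * padicValInt p cM + padicValRat p qd := by
    rw [padicValRat.mul hD5 hua, padicValRat.mul hD4 hqd0, padicValRat.mul hD3 (pow_ne_zero _ hw'),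
      padicValRat.mul hD2 (pow_ne_zero _ hcM), padicValRat.mul hD1 (pow_ne_zero _ htKq),
      padicValRat.mul hn' hm', padicValRat.pow, padicValRat.pow, padicValRat.pow, hvn, hvm, hvw,
      hvu, padicValRat.of_nat, padicValRat.of_int]
    push_cast; ring
  rw [hqQ, hQ_def, padicValRat.div hA1 hD6, hnum, hden]
  ring

end Summit.BirchSwinnertonDyer.Rank1Residual

end
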